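import Summits.BirchSwinnertonDyer.BirchSwinnertonDyer.Theorems.AdditiveKolyvaginRoadKolyvaginConjStableTransverse
import Summits.BirchSwinnertonDyer.BirchSwinnertonDyer.Theorems.AdditiveKolyvaginRoadKolyvaginToricConj
import HarnessLib

/-!
# Route `AdditiveKolyvaginRoad`, crux `KolyvaginPrimitiveAdditive` (item stmt-BirchSwinnertonDyer-20132):
# stub LOC, towards (Supply) at a general prime `p` — (Stab): the relaxed level structure `G(n, ℓ, T)` of the
# additive route (Kummer off the level, TORIC above `n ⊆ AdmQ`, TRANSVERSE on `T`, free at `λ ∋ ℓ`) is stable under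
# complex conjugation (p-generic port of §4 of koly3b's `…ZhangSupplyConjStable`, ordinary ↦ toric, in the place
# currency of `AdditiveKoly.KolyvaginLocalPackageP.supply`)
# (cell `pub/bsd-wall`, lead prover `bsd-wall-akr-p1` g3; `--supports stmt-BirchSwinnertonDyer-20132`, helper)

WHY THIS FILE. (Stab) is the binder `hstab` of the signed jump (`supply_signed_of_jump_good`) in the GLOBAL half of
(Supply) (PORT MAP in HOME/bsd-wall-akr-p1/NOTES_g3.md). Ingredients: complex places carry no condition
(`selmerLocalKer_eq_top_of_isAlgClosed`); Kummer transport (tree `conjAct_mem_selmerLocalKer_iff` along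
`galAdicCompletionEquiv c : K_{c⁻¹v} ≃ K_v`); toric transport (`conjAct_mem_toricLocalKer_adicCompletion_iff`);
transverse transport (`conjAct_mem_transverseLocalKerP_of_mem`); natural numbers are `Aut(K/ℚ)`-fixed, so «`q ∈ v`» is
`c`-invariant. The frame of the conditions is the one of `KolyvaginLocalPackageP.supply` (places described by
`(q : 𝓞 K) ∈ v.asIdeal`, no enumeration `plK`).

WHAT. `conjAct_mem_relaxedGroupP`.

HONEST FRAMING: one theorem; 0 definitions, 0 named facts, 0 `sorry`; closes nothing.

References: [cite: GrossLMS1991, §5 (5.1)] [cite: WZhang2014, §8.1] [cite: BertoliniDarmon2005, §2.2–§2.3].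
-/

-- single-conjunct summit: `Summit.BirchSwinnertonDyer.BirchSwinnertonDyer.…` repeats the name by design
set_option linter.dupNamespace false

noncomputable section

open scoped Classical Pointwise

namespace Summit.BirchSwinnertonDyer.BirchSwinnertonDyer.Theorems.AdditiveKoly

open WeierstrassCurve NumberField IsDedekindDomain Field
  Literature.NumberTheory.EllipticCurves Literature.NumberTheory.GaloisRepresentations
  Literature.NumberTheory.Automorphic
open Summit.BirchSwinnertonDyer.Rank1Residual.X11b
open Summit.BirchSwinnertonDyer.Rank1Residual.X11b.Three.Koly.ZhangSupply.LocalConj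

variable {K : Type} [Field K] [NumberField K] (W : WeierstrassCurve ℚ) (p : ℕ) [W.IsGloballyMinimal]

/-- **(Stab) for the additive route's relaxed level structure.** For `K` imaginary quadratic with complex conjugation
`c ≠ 1`, a level `n ⊆ AdmQ`, a Kolyvagin prime `ℓ` and a finite set `T` of Kolyvagin primes: if `x ∈ H¹(K, E[p])`
satisfies E's Kummer condition at the infinite places and at the finite places away from `ℓ`, `T` and `n`, the TORIC
condition above `n` (away from `ℓ`, `T`) and the TRANSVERSE condition above `T`, then so does `c_* x`.
[cite: GrossLMS1991, §5 (5.1)] [cite: WZhang2014, §8.1] [cite: BertoliniDarmon2005, §2.2–§2.3] -/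
theorem conjAct_mem_relaxedGroupP (hK : IsImaginaryQuadratic K) {c : K ≃ₐ[ℚ] K} (hc : c ≠ 1) (ι : K →+* ℂ)
    (n : Finset (AdmQ W K p)) (ℓ : {ℓ // Zhang2014.IsKolyvaginPrime (W.conductorNorm ℤ) W K p ℓ})
    (T : Finset {ℓ // Zhang2014.IsKolyvaginPrime (W.conductorNorm ℤ) W K p ℓ}) (x : Vp W K p)
    (hx : (∀ w : InfinitePlace K, x ∈ selmerLocalKer (W.baseChange K) w.Completion ((p ^ 1 : ℕ) : ℤ)) ∧
      (∀ v : HeightOneSpectrum (𝓞 K), ((ℓ : ℕ) : 𝓞 K) ∉ v.asIdeal →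
        (∀ ℓ' ∈ T, ((ℓ' : ℕ) : 𝓞 K) ∉ v.asIdeal) →
        ((∀ q ∈ n, ((q : ℕ) : 𝓞 K) ∉ v.asIdeal) →
          x ∈ selmerLocalKer (W.baseChange K) (v.adicCompletion K) ((p ^ 1 : ℕ) : ℤ)) ∧
        (∀ q ∈ n, ((q : ℕ) : 𝓞 K) ∈ v.asIdeal →
          x ∈ toricLocalKer (W.baseChange K) (v.adicCompletion K) ((p ^ 1 : ℕ) : ℤ))) ∧
      (∀ ℓ' ∈ T, ∀ v : HeightOneSpectrum (𝓞 K), ((ℓ' : ℕ) : 𝓞 K) ∈ v.asIdeal →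
        x ∈ transverseLocalKerP W K p ι ℓ' v)) :
    (∀ w : InfinitePlace K,
        conjAct W c ((p ^ 1 : ℕ) : ℤ) x ∈ selmerLocalKer (W.baseChange K) w.Completion ((p ^ 1 : ℕ) : ℤ)) ∧
      (∀ v : HeightOneSpectrum (𝓞 K), ((ℓ : ℕ) : 𝓞 K) ∉ v.asIdeal →
        (∀ ℓ' ∈ T, ((ℓ' : ℕ) : 𝓞 K) ∉ v.asIdeal) →
        ((∀ q ∈ n, ((q : ℕ) : 𝓞 K) ∉ v.asIdeal) →
          conjAct W c ((p ^ 1 : ℕ) : ℤ) x ∈ selmerLocalKer (W.baseChange K) (v.adicCompletion K) ((p ^ 1 : ℕ) : ℤ)) ∧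
        (∀ q ∈ n, ((q : ℕ) : 𝓞 K) ∈ v.asIdeal →
          conjAct W c ((p ^ 1 : ℕ) : ℤ) x ∈ toricLocalKer (W.baseChange K) (v.adicCompletion K) ((p ^ 1 : ℕ) : ℤ))) ∧
      (∀ ℓ' ∈ T, ∀ v : HeightOneSpectrum (𝓞 K), ((ℓ' : ℕ) : 𝓞 K) ∈ v.asIdeal →
        conjAct W c ((p ^ 1 : ℕ) : ℤ) x ∈ transverseLocalKerP W K p ι ℓ' v) := by
  haveI : IsTotallyComplex K := hK.2
  -- natural numbers are fixed by `Aut(K/ℚ)`; «`q` lies in `v`» is invariant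
  have hnat : ∀ (σ : K ≃ₐ[ℚ] K) (v : HeightOneSpectrum (𝓞 K)) (q : ℕ),
      (q : 𝓞 K) ∈ (σ • v).asIdeal ↔ (q : 𝓞 K) ∈ v.asIdeal := by
    intro σ v q
    have hq : σ • (q : 𝓞 K) = (q : 𝓞 K) := map_natCast (MulSemiringAction.toRingHom (K ≃ₐ[ℚ] K) (𝓞 K) σ) q
    rw [← HeightOneSpectrum.smul_mem_smul_asIdeal_iff σ v (q : 𝓞 K), hq]
  refine ⟨fun w ↦ ?_, fun v hv hvT ↦ ?_, fun ℓ' hℓ' v hv ↦ ?_⟩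
  · -- complex places carry no condition
    haveI : IsAlgClosed w.Completion :=
      isAlgClosed_of_ringEquiv (InfinitePlace.Completion.ringEquivComplexOfIsComplex (IsTotallyComplex.isComplex w)).symm
    rw [WeierstrassCurve.selmerLocalKer_eq_top_of_isAlgClosed]
    trivial
  · -- finite places off `ℓ` and `T`: transport from `v₀ = c⁻¹ • v`
    have h0 : c • (c⁻¹ • v) = v := smul_inv_smul c v
    have hv₀ : ((ℓ : ℕ) : 𝓞 K) ∉ (c⁻¹ • v).asIdeal := fun h ↦ hv ((hnat c⁻¹ v ℓ).mp h)
    have hv₀T : ∀ ℓ' ∈ T, ((ℓ' : ℕ) : 𝓞 K) ∉ (c⁻¹ • v).asIdeal :=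
      fun ℓ' hℓ'T h ↦ hvT ℓ' hℓ'T ((hnat c⁻¹ v ℓ').mp h)
    haveI : CharZero ((c⁻¹ • v).adicCompletion K) := charZero_of_injective_algebraMap (algebraMap K _).injective
    haveI : CharZero (v.adicCompletion K) := charZero_of_injective_algebraMap (algebraMap K _).injective
    obtain ⟨hk, ho⟩ := hx.2.1 (c⁻¹ • v) hv₀ hv₀T
    refine ⟨fun hq ↦ ?_, fun q hq hqv ↦ ?_⟩
    · exact (conjAct_mem_selmerLocalKer_iff W c (galAdicCompletionEquiv (L := K) c h0)
        (isSemilinearRingEquiv_galAdicCompletionEquiv c h0) _ x).mpr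
        (hk fun q hqn hqv ↦ hq q hqn ((hnat c⁻¹ v q).mp hqv))
    · exact (conjAct_mem_toricLocalKer_adicCompletion_iff W c h0 _ x).mpr
        (ho q hq ((hnat c⁻¹ v q).mpr hqv))
  · -- transverse above the primes of `T`
    exact conjAct_mem_transverseLocalKerP_of_mem W p hK hc ι ℓ'.2.1 ℓ'.2.2.2.2.2.1 hv (hx.2.2 ℓ' hℓ' v hv)

end Summit.BirchSwinnertonDyer.BirchSwinnertonDyer.Theorems.AdditiveKoly

end
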